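import Literature.NumberTheory.Weil1964.ArchWeilDatum
import Literature.Analysis.SegalBargmann.SchwartzCompactWeilRep
import Mathlib.Topology.Maps.Proper.Basic
import HarnessLib

/-!
# Strong continuity of a Heisenberg-covariant representation from its vacuum character and a `KAK` decomposition (Folland 1989 §4.2; Knapp 2002 Thm 7.39)

Topic `NumberTheory/Weil1964`; namespace `Literature.NumberTheory.Weil1964`.  Continuation of
`Literature.NumberTheory.Weil1964.ArchWeilDatum` (`IsArchWeilDatum ι𝕎 ω`: (w1) strong continuity of
`g ↦ ω g f` into the Fréchet space `𝓢(ℝ^σ)`, (w2) Heisenberg covariance over `ι𝕎`, (w2′) unitary lifts).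

**The point of this file.**  Of the three clauses of `IsArchWeilDatum`, (w2) and (w2′) are ALGEBRAIC (they are
what a splitting homomorphism into the metaplectic group of MVW / Konno–Konno provides), while (w1) is ANALYTIC
and is not printed by the sources in the form the tree needs.  (w1) does NOT follow from (w2)+(w2′) alone: twisting
`ω` by a discontinuous unitary character of `G` preserves (w2)+(w2′) and destroys (w1).  This file proves that
(w1) DOES follow from (w2)+(w2′) together with

* (K) on a subgroup `κ : K →* G` an explicit covariant family `W_K` with unitary lifts, jointly continuous on
  `K × 𝓢`, such that the two VACUUM ORBITS `k ↦ ω(κ k) h₀`, `k ↦ W_K(k) h₀` are continuous (for the oscillator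
  representation of a dual pair `ω(κ k) h₀ = χ(k) • h₀` with a continuous character `χ` — Konno–Konno's
  Lemma 5.2 / Kashiwara–Vergne — so this is the one place where the printed VACUUM CHARACTER enters);
* (A) on a one-parameter subgroup `a : ℝ → G` an explicit covariant one-parameter family `W_A` with unitary
  lifts, jointly continuous on `ℝ × 𝓢`;
* (W) a WEYL ELEMENT `w : K` with `κ w · a t · (κ w)⁻¹ = a (-t)` (real rank one);
* (M) `(k₁, t, k₂) ↦ κ k₁ · a t · κ k₂` is a PROPER SURJECTION `K × ℝ × K → G` (the `KAK` decomposition,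
  Knapp Thm 7.39, with properness from compactness of `K`),

WITHOUT presupposing any continuity or boundedness of `ω` on `𝓢`.  Mechanism: by Folland's Schur remark
(T9 `IsPhaseCovariant.eq_smul`) `ω(κ k) = c(k) • W_K(k)` and `ω(a t) = d(t) • W_A(t)` on `𝓢` with `|c| = |d| = 1`;
`c` is a relative coefficient of two families with continuous vacuum orbits, hence continuous
(`continuous_relCoeff`); for `d` no vacuum information is available (the boost moves the vacuum) and the Weyl
element replaces it: `W_K(w) W_A(t) W_K(w)⁻¹ = e(t) • W_A(-t)` with `e` a relative coefficient of two STRONGLY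
CONTINUOUS explicit families (so `e` is continuous), while `ω(κ w) ω(a t) ω(κ w)⁻¹ = ω(a(-t))` forces
`d(-t) = d(t) e(t)`; with `d(-t) = d(t)⁻¹` and `d(t) = d(t/2)²` this gives `d(t) = e(t/2)⁻¹` — continuous
(§3 `exists_continuous_smul_of_weyl`).  Then `ω(κ k₁ · a t · κ k₂) f = (c k₁ · d t · c k₂) • W_K k₁ (W_A t (W_K k₂ f))`
is jointly continuous on `(K × ℝ × K) × 𝓢` (§4) and descends along the proper surjection `m × id_𝓢`
(`IsProperMap.prodMap`, `IsClosedMap.isQuotientMap`, `IsQuotientMap.continuous_iff`; §5).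

* §1 pointwise Schur on `𝓢` for two covariant families with unitary lifts (`eq_relCoeff_smul_of_liftsTo`),
  vacuum orbits (`continuous_lift_vacL2`), injectivity (`ne_zero_of_liftsTo`).
* §2 (K): `exists_continuous_smul_of_vacuum`, `continuous_uncurry_of_vacuum`.
* §3 (A)+(W): `exists_continuous_smul_of_weyl`.
* §4 the block: `continuous_uncurry_kakBlock`.
* §5 descent: `continuous_uncurry_of_isProperMap`, **`continuous_uncurry_of_kak`**, **`continuous_apply_of_kak`**,
  and the datum **`isArchWeilDatum_of_kak`** (also the purely compact case `isArchWeilDatum_of_vacuum`).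
* §6 (K) discharged by the tree's `μ₀ = unitaryOpPi` (T7 `SchwartzUnitaryIdentification`):
  `isArchWeilDatum_of_kak_unitary`, `isArchWeilDatum_of_vacuum_unitary` — the only remaining (K)-input is the
  continuity of the vacuum orbit `k ↦ ω(κ k) h₀`.

Everything is PROVED from Mathlib and the imported tree files; no cited fact is a hypothesis.  Mathlib has proper
maps and quotient maps (`IsProperMap`, `IsQuotientMap`) but no Schrödinger/oscillator representation
(`lean search 'IsPhaseCovariant|relCoeff|compactWeilRep'`: tree only).

## References

* [Folland1989] G. B. Folland, *Harmonic Analysis in Phase Space*, Annals of Mathematics Studies 122, Princeton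
  University Press, 1989: §4.2, (4.23) and the Schur remark p. 156 ("`μ(𝒜)` is determined up to a phase factor");
  Prop. (4.39) (doi:10.1515/9781400882427).
* [Knapp2002] A. W. Knapp, *Lie Groups Beyond an Introduction*, 2nd ed., Progress in Mathematics 140, Birkhäuser,
  2002: Theorem 7.39 (the `KAK` decomposition `G = K A K` of a reductive Lie group), p. 457.
* [KonnoKonno2007] K. Konno, T. Konno, *On doubling construction for real unitary dual pairs*, Kyushu J. Math. 61
  (2007) 35–82: §3.3 (splittings `U(V) × U(W) → Mp`), Lemma 5.2 (the action of `K_V × K_W` on the Gaussian)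
  (doi:10.2206/kyushujm.61.35).
-/

noncomputable section

open MeasureTheory Complex SchwartzMap
open scoped InnerProductSpace ComplexConjugate Real

namespace Literature.NumberTheory.Weil1964

open Literature.Analysis.SegalBargmann Literature.RepresentationTheory.HeisenbergGroup

variable {σ : Type*} [Fintype σ] [DecidableEq σ]

local notation "L2R" σ => Lp ℂ 2 (volume : Measure (σ → ℝ))
local notation "SR" σ => SchwartzMap (σ → ℝ) ℂ
local notation "PV" σ => (σ → ℝ) × (σ → ℝ)
local notation "SpR" σ => symplecticGroup (polar (dotPairing σ))

/-- Notation used throughout (NOT a definition): `HasUnitaryLift[σ] A` abbreviates the (w2′) clause shape of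
`IsArchWeilDatum.exists_lift` — `A : 𝓢 →ₗ 𝓢` is the restriction of SOME unitary operator of `L²(ℝ^σ)`. -/
local notation "HasUnitaryLift[" σ "]" A:max =>
  ∃ U : Lp ℂ 2 (volume : Measure (σ → ℝ)) ≃ₗᵢ[ℂ] Lp ℂ 2 (volume : Measure (σ → ℝ)),
    LiftsTo A ((LinearIsometryEquiv.toContinuousLinearEquiv U :
        Lp ℂ 2 (volume : Measure (σ → ℝ)) ≃L[ℂ] Lp ℂ 2 (volume : Measure (σ → ℝ))) :
      Lp ℂ 2 (volume : Measure (σ → ℝ)) →L[ℂ] Lp ℂ 2 (volume : Measure (σ → ℝ)))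

/-! ## 1. Pointwise Schur on `𝓢` for lifted covariant families -/

section Schur

variable {H : Type*}

omit [DecidableEq σ] in
/-- Choosing the lifts of a family with unitary lifts. [folklore] -/
theorem exists_liftFamily {A : H → ((SR σ) →ₗ[ℂ] SR σ)} (h : ∀ x, HasUnitaryLift[σ] (A x)) :
    ∃ U : H → ((L2R σ) ≃ₗᵢ[ℂ] L2R σ), ∀ x, LiftsTo (A x) (liftCLM U x) := by
  choose U hU using h
  exact ⟨U, hU⟩

/-- **Schur on `𝓢`, pointwise**: two families of operators of `𝓢(ℝ^σ)` that are Heisenberg-covariant over the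
SAME phase-space maps and have unitary lifts differ by the relative coefficient of the lifts:
`A′ x f = relCoeff U U′ x • A x f`.  No structure on the index type. [cite: Folland1989, §4.2, (4.23) and the Schur remark p. 156] -/
theorem eq_relCoeff_smul_of_liftsTo {γ : H → PhaseMap σ} {A A' : H → ((SR σ) →ₗ[ℂ] SR σ)}
    {U U' : H → ((L2R σ) ≃ₗᵢ[ℂ] L2R σ)} (hA : IsPhaseCovariantS γ A) (hA' : IsPhaseCovariantS γ A')
    (hU : ∀ x, LiftsTo (A x) (liftCLM U x)) (hU' : ∀ x, LiftsTo (A' x) (liftCLM U' x)) (x : H) (f : SR σ) :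
    A' x f = relCoeff U U' x • A x f := by
  apply toL2_injective
  have h1 := hU' x f
  have h2 := hU x f
  simp only [liftCLM_apply] at h1 h2
  rw [h1, map_smul, h2]
  exact (hA.lift hU).eq_smul (hA'.lift hU') x (toL2 f)

/-- The relative coefficient has modulus one. [cite: Folland1989, §4.2, the Schur remark p. 156] -/
theorem norm_relCoeff_of_liftsTo {γ : H → PhaseMap σ} {A A' : H → ((SR σ) →ₗ[ℂ] SR σ)}
    {U U' : H → ((L2R σ) ≃ₗᵢ[ℂ] L2R σ)} (hA : IsPhaseCovariantS γ A) (hA' : IsPhaseCovariantS γ A')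
    (hU : ∀ x, LiftsTo (A x) (liftCLM U x)) (hU' : ∀ x, LiftsTo (A' x) (liftCLM U' x)) (x : H) :
    ‖relCoeff U U' x‖ = 1 :=
  (hA.lift hU).norm_relCoeff (hA'.lift hU') x

/-- The `L²`-vacuum orbit of the lifts is the image of the `𝓢`-orbit of the Gaussian `h₀ = hermitePi 0`; so it is
continuous as soon as the latter is. [folklore] -/
theorem continuous_lift_vacL2 [TopologicalSpace H] {A : H → ((SR σ) →ₗ[ℂ] SR σ)}
    {U : H → ((L2R σ) ≃ₗᵢ[ℂ] L2R σ)} (hU : ∀ x, LiftsTo (A x) (liftCLM U x))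
    (hc : Continuous fun x => A x (hermitePi 0)) : Continuous fun x => U x (vacL2 : L2R σ) := by
  have h1 : (fun x => U x (vacL2 : L2R σ)) = fun x => toL2 (A x (hermitePi 0)) := by
    funext x
    have h2 := hU x (hermitePi 0)
    rw [liftCLM_apply, toL2_hermitePi_zero] at h2
    exact h2.symm
  rw [h1]
  exact toL2.continuous.comp hc

omit [DecidableEq σ] in
/-- A lifted operator is injective on `𝓢`. [folklore] -/
theorem ne_zero_of_liftsTo {A : (SR σ) →ₗ[ℂ] SR σ} {U : (L2R σ) ≃ₗᵢ[ℂ] L2R σ}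
    (hA : LiftsTo A ((U.toContinuousLinearEquiv : (L2R σ) ≃L[ℂ] L2R σ) : (L2R σ) →L[ℂ] L2R σ))
    {f : SR σ} (hf : f ≠ 0) : A f ≠ 0 := by
  intro h0
  apply hf
  apply toL2_injective
  have h1 := hA f
  rw [h0, map_zero] at h1
  have h2 : U (toL2 f) = 0 := by simpa using h1.symm
  rw [map_zero]
  exact (LinearIsometryEquiv.map_eq_zero_iff U).1 h2

/-- The Gaussian `h₀ = hermitePi 0` is a nonzero Schwartz function. [folklore] -/
theorem hermitePi_zero_ne_zero : (hermitePi (0 : σ →₀ ℕ) : SR σ) ≠ 0 := by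
  intro h0
  have h1 := toL2_hermitePi_zero (σ := σ)
  rw [h0, map_zero] at h1
  exact vacL2_ne_zero h1.symm

end Schur

/-! ## 2. (K): the scalar on a subgroup with continuous vacuum orbits -/

section Vacuum

variable {K : Type*} [TopologicalSpace K]

/-- **(K) The compact part.**  If `A k` (think `ω(κ k)`) and an explicit family `W k` are covariant over the same
phase maps, both have unitary lifts, and both vacuum orbits `k ↦ A k h₀`, `k ↦ W k h₀` are continuous, then
`A k = c(k) • W k` on `𝓢` with `c` CONTINUOUS of modulus one. [cite: Folland1989, §4.2, the Schur remark p. 156] -/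
theorem exists_continuous_smul_of_vacuum {γK : K → PhaseMap σ} {A : K → ((SR σ) →ₗ[ℂ] SR σ)}
    (hA : IsPhaseCovariantS γK A) (hAl : ∀ k, HasUnitaryLift[σ] (A k))
    (hAvac : Continuous fun k => A k (hermitePi 0))
    {W : K → ((SR σ) →L[ℂ] SR σ)} (hW : IsPhaseCovariantS γK (fun k => ((W k : (SR σ) →L[ℂ] SR σ) : (SR σ) →ₗ[ℂ] SR σ)))
    (hWl : ∀ k, HasUnitaryLift[σ] ((W k : (SR σ) →L[ℂ] SR σ) : (SR σ) →ₗ[ℂ] SR σ))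
    (hWvac : Continuous fun k => W k (hermitePi 0)) :
    ∃ c : K → ℂ, Continuous c ∧ (∀ k, ‖c k‖ = 1) ∧ ∀ k f, A k f = c k • W k f := by
  obtain ⟨U, hU⟩ := exists_liftFamily hWl
  obtain ⟨U', hU'⟩ := exists_liftFamily hAl
  have hWvac' : Continuous fun k => ((W k : (SR σ) →L[ℂ] SR σ) : (SR σ) →ₗ[ℂ] SR σ) (hermitePi 0) := by
    simpa only [ContinuousLinearMap.coe_coe] using hWvac
  refine ⟨relCoeff U U', continuous_relCoeff (continuous_lift_vacL2 hU hWvac') (continuous_lift_vacL2 hU' hAvac),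
    norm_relCoeff_of_liftsTo hW hA hU hU', fun k f => ?_⟩
  have h1 := eq_relCoeff_smul_of_liftsTo hW hA hU hU' k f
  simpa only [ContinuousLinearMap.coe_coe] using h1

/-- … hence `(k, f) ↦ A k f` is jointly continuous into `𝓢` when `(k, f) ↦ W k f` is. [folklore] -/
theorem continuous_uncurry_of_vacuum {γK : K → PhaseMap σ} {A : K → ((SR σ) →ₗ[ℂ] SR σ)}
    (hA : IsPhaseCovariantS γK A) (hAl : ∀ k, HasUnitaryLift[σ] (A k))
    (hAvac : Continuous fun k => A k (hermitePi 0))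
    {W : K → ((SR σ) →L[ℂ] SR σ)} (hW : IsPhaseCovariantS γK (fun k => ((W k : (SR σ) →L[ℂ] SR σ) : (SR σ) →ₗ[ℂ] SR σ)))
    (hWl : ∀ k, HasUnitaryLift[σ] ((W k : (SR σ) →L[ℂ] SR σ) : (SR σ) →ₗ[ℂ] SR σ))
    (hWc : Continuous fun x : K × SR σ => W x.1 x.2) :
    Continuous fun x : K × SR σ => A x.1 x.2 := by
  have hWvac : Continuous fun k => W k (hermitePi 0) :=
    hWc.comp (continuous_id.prodMk continuous_const)
  obtain ⟨c, hc, -, hcW⟩ := exists_continuous_smul_of_vacuum hA hAl hAvac hW hWl hWvac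
  have h1 : (fun x : K × SR σ => A x.1 x.2) = fun x => c x.1 • W x.1 x.2 := funext fun x => hcW x.1 x.2
  rw [h1]
  exact (hc.comp continuous_fst).smul hWc

end Vacuum

/-! ## 3. (A)+(W): the scalar on a one-parameter subgroup from a Weyl element -/

section Weyl

/-- **(A)+(W) The split part.**  `B t` (think `ω(a t)`) and an explicit family `V t` are covariant over the same
phase maps `γA t`, have unitary lifts, are "one-parameter" (`X t = X (t/2) ∘ X (t/2)`, `X t ∘ X (-t) = id`), and
`t ↦ V t f` is continuous for every `f`.  A WEYL OPERATOR `Y` — covariant over a phase map `φ` that reverses the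
parameter (`φ ∘ γA t = γA (-t) ∘ φ`), with a unitary lift, and conjugating `B t` to `B (-t)` — forces the
relative scalar `d`, `B t = d(t) • V t`, to be CONTINUOUS: `d t = e(t/2)⁻¹` where `Y ∘ V t = e(t) • V(-t) ∘ Y`.
[cite: Folland1989, §4.2, the Schur remark p. 156] -/
theorem exists_continuous_smul_of_weyl {γA : ℝ → PhaseMap σ} {B : ℝ → ((SR σ) →ₗ[ℂ] SR σ)}
    (hB : IsPhaseCovariantS γA B) (hBl : ∀ t, HasUnitaryLift[σ] (B t))
    {V : ℝ → ((SR σ) →L[ℂ] SR σ)} (hV : IsPhaseCovariantS γA (fun t => ((V t : (SR σ) →L[ℂ] SR σ) : (SR σ) →ₗ[ℂ] SR σ)))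
    (hVl : ∀ t, HasUnitaryLift[σ] ((V t : (SR σ) →L[ℂ] SR σ) : (SR σ) →ₗ[ℂ] SR σ))
    (hVc : ∀ f : SR σ, Continuous fun t => V t f)
    (hB2 : ∀ t f, B t f = B (t / 2) (B (t / 2) f)) (hV2 : ∀ t f, V t f = V (t / 2) (V (t / 2) f))
    (hBinv : ∀ t f, B t (B (-t) f) = f) (hVinv : ∀ t f, V t (V (-t) f) = f)
    {φ : PhaseMap σ} {Y : (SR σ) →L[ℂ] SR σ}
    (hY : ∀ (p q : σ → ℝ) (f : SR σ), Y (rhoS p q f) = rhoS (φ (p, q)).1 (φ (p, q)).2 (Y f))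
    (hYl : HasUnitaryLift[σ] ((Y : (SR σ) →L[ℂ] SR σ) : (SR σ) →ₗ[ℂ] SR σ))
    (hφ : ∀ t pq, φ (γA t pq) = γA (-t) (φ pq))
    (hYB : ∀ t f, Y (B t f) = B (-t) (Y f)) :
    ∃ d : ℝ → ℂ, Continuous d ∧ (∀ t, ‖d t‖ = 1) ∧ ∀ t f, B t f = d t • V t f := by
  obtain ⟨UB, hUB⟩ := exists_liftFamily hBl
  obtain ⟨UV, hUV⟩ := exists_liftFamily hVl
  obtain ⟨UY, hUY⟩ := hYl
  -- the relative scalar `d`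
  set d : ℝ → ℂ := relCoeff UV UB with hd_def
  have hd : ∀ t f, B t f = d t • V t f := fun t f => by
    have h1 := eq_relCoeff_smul_of_liftsTo hV hB hUV hUB t f
    simpa only [ContinuousLinearMap.coe_coe] using h1
  have hd1 : ∀ t, ‖d t‖ = 1 := norm_relCoeff_of_liftsTo hV hB hUV hUB
  have hd0 : ∀ t, d t ≠ 0 := fun t h0 => by simpa [h0] using hd1 t
  -- the two conjugated families `F₁ t = V(-t) ∘ Y`, `F₂ t = Y ∘ V t`, covariant over `φ ∘ γA t`
  set F₁ : ℝ → ((SR σ) →ₗ[ℂ] SR σ) := fun t =>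
    ((V (-t) : (SR σ) →L[ℂ] SR σ) : (SR σ) →ₗ[ℂ] SR σ).comp ((Y : (SR σ) →L[ℂ] SR σ) : (SR σ) →ₗ[ℂ] SR σ)
    with hF₁
  set F₂ : ℝ → ((SR σ) →ₗ[ℂ] SR σ) := fun t =>
    ((Y : (SR σ) →L[ℂ] SR σ) : (SR σ) →ₗ[ℂ] SR σ).comp ((V t : (SR σ) →L[ℂ] SR σ) : (SR σ) →ₗ[ℂ] SR σ)
    with hF₂
  have hF₁app : ∀ t f, F₁ t f = V (-t) (Y f) := fun t f => rfl
  have hF₂app : ∀ t f, F₂ t f = Y (V t f) := fun t f => rfl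
  have hF₁cov : IsPhaseCovariantS (fun t pq => φ (γA t pq)) F₁ := by
    intro t p q f
    show V (-t) (Y (rhoS p q f)) = rhoS (φ (γA t (p, q))).1 (φ (γA t (p, q))).2 (V (-t) (Y f))
    rw [hY, hφ]
    have h1 := hV (-t) (φ (p, q)).1 (φ (p, q)).2 (Y f)
    simpa only [ContinuousLinearMap.coe_coe, Prod.mk.eta] using h1
  have hF₂cov : IsPhaseCovariantS (fun t pq => φ (γA t pq)) F₂ := by
    intro t p q f
    show Y (V t (rhoS p q f)) = rhoS (φ (γA t (p, q))).1 (φ (γA t (p, q))).2 (Y (V t f))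
    have h1 := hV t p q f
    simp only [ContinuousLinearMap.coe_coe] at h1
    rw [h1, hY]
  set U₁ : ℝ → ((L2R σ) ≃ₗᵢ[ℂ] L2R σ) := fun t => UY.trans (UV (-t)) with hU₁
  set U₂ : ℝ → ((L2R σ) ≃ₗᵢ[ℂ] L2R σ) := fun t => (UV t).trans UY with hU₂
  have hU₁l : ∀ t, LiftsTo (F₁ t) (liftCLM U₁ t) := fun t f => by
    have h1 := hUV (-t) (Y f)
    have h2 := hUY f
    simp only [liftCLM_apply, ContinuousLinearMap.coe_coe] at h1
    rw [hF₁app, liftCLM_apply, h1]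
    change UV (-t) (toL2 (((Y : (SR σ) →L[ℂ] SR σ) : (SR σ) →ₗ[ℂ] SR σ) f)) = UV (-t) (UY (toL2 f))
    rw [h2]
    rfl
  have hU₂l : ∀ t, LiftsTo (F₂ t) (liftCLM U₂ t) := fun t f => by
    have h1 := hUV t f
    have h2 := hUY (V t f)
    simp only [liftCLM_apply, ContinuousLinearMap.coe_coe] at h1 h2
    rw [hF₂app, liftCLM_apply]
    change toL2 (Y (V t f)) = UY (UV t (toL2 f))
    rw [← h1]
    exact h2
  -- the conjugation scalar `e`, continuous because both families are strongly continuous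
  set e : ℝ → ℂ := relCoeff U₁ U₂ with he_def
  have he : ∀ t f, Y (V t f) = e t • V (-t) (Y f) := fun t f => by
    have h1 := eq_relCoeff_smul_of_liftsTo hF₁cov hF₂cov hU₁l hU₂l t f
    rwa [hF₂app, hF₁app] at h1
  have he1 : ∀ t, ‖e t‖ = 1 := norm_relCoeff_of_liftsTo hF₁cov hF₂cov hU₁l hU₂l
  have he0 : ∀ t, e t ≠ 0 := fun t h0 => by simpa [h0] using he1 t
  have hec : Continuous e := by
    refine continuous_relCoeff (continuous_lift_vacL2 hU₁l ?_) (continuous_lift_vacL2 hU₂l ?_)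
    · simp only [hF₁app]
      exact (hVc (Y (hermitePi 0))).comp continuous_neg
    · simp only [hF₂app]
      exact Y.continuous.comp (hVc (hermitePi 0))
  -- the algebra: d(-t) d(t) = 1, d(-t) = d(t) e(t), d(t) = d(t/2)^2
  have hV0 : ∀ t (g : SR σ), g ≠ 0 → V t g ≠ 0 := fun t g hg => by
    obtain ⟨U, hU⟩ := hVl t
    have := ne_zero_of_liftsTo hU hg
    simpa only [ContinuousLinearMap.coe_coe] using this
  have hY0 : ∀ g : SR σ, g ≠ 0 → Y g ≠ 0 := fun g hg => by
    have := ne_zero_of_liftsTo hUY hg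
    simpa only [ContinuousLinearMap.coe_coe] using this
  have h₀ne : (hermitePi (0 : σ →₀ ℕ) : SR σ) ≠ 0 := hermitePi_zero_ne_zero
  have hinv : ∀ t, d (-t) * d t = 1 := fun t => by
    have h1 := hBinv t (hermitePi 0)
    rw [hd (-t), map_smul, hd t, smul_smul, hVinv] at h1
    have h2 : (d (-t) * d t) • (hermitePi (0 : σ →₀ ℕ) : SR σ) = (1 : ℂ) • hermitePi 0 := by
      rw [one_smul]; exact h1
    exact smul_left_injective ℂ h₀ne h2
  have hconj : ∀ t, d (-t) = d t * e t := fun t => by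
    have h1 := hYB t (hermitePi 0)
    rw [hd t, map_smul, he t, hd (-t), smul_smul] at h1
    have hne : V (-t) (Y (hermitePi 0)) ≠ 0 := hV0 _ _ (hY0 _ h₀ne)
    exact (smul_left_injective ℂ hne h1).symm
  have hhalf : ∀ t, d t = d (t / 2) * d (t / 2) := fun t => by
    have h1 := hB2 t (hermitePi 0)
    rw [hd t, hd (t / 2) (hermitePi 0), map_smul, hd (t / 2), smul_smul, ← hV2] at h1
    have hne : V t (hermitePi 0) ≠ 0 := hV0 _ _ h₀ne
    exact smul_left_injective ℂ hne h1
  have hsq : ∀ s, d s * d s = (e s)⁻¹ := fun s => by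
    have h1 : d (-s) = (d s)⁻¹ := eq_inv_of_mul_eq_one_left (hinv s)
    have h2 := hconj s
    rw [h1] at h2
    -- (d s)⁻¹ = d s * e s  ⇒  d s * d s = (e s)⁻¹
    have h3 : d s * d s * e s = 1 := by
      calc d s * d s * e s = d s * (d s * e s) := by ring
        _ = d s * (d s)⁻¹ := by rw [← h2]
        _ = 1 := mul_inv_cancel₀ (hd0 s)
    exact eq_inv_of_mul_eq_one_left h3
  have hformula : ∀ t, d t = (e (t / 2))⁻¹ := fun t => by rw [hhalf t, hsq]
  refine ⟨d, ?_, hd1, hd⟩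
  have h1 : d = fun t => (e (t / 2))⁻¹ := funext hformula
  rw [h1]
  exact (hec.comp (continuous_id.div_const 2)).inv₀ fun t => he0 _

end Weyl

/-! ## 4. The `KAK` block -/

section Block

variable {G : Type*} [Group G] [TopologicalSpace G] {K : Type*} [Group K] [TopologicalSpace K]

omit [TopologicalSpace G] in
/-- A one-parameter map into a group sends `0` to `1`. [folklore] -/
theorem oneParam_zero {a : ℝ → G} (ha : ∀ s t, a (s + t) = a s * a t) : a 0 = 1 := by
  have h1 := ha 0 0
  rw [add_zero] at h1
  exact (mul_eq_left.1 h1.symm)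

omit [TopologicalSpace G] in
/-- … and `a t * a (-t) = 1`. [folklore] -/
theorem oneParam_mul_neg {a : ℝ → G} (ha : ∀ s t, a (s + t) = a s * a t) (t : ℝ) : a t * a (-t) = 1 := by
  rw [← ha, add_neg_cancel, oneParam_zero ha]

omit [TopologicalSpace G] in
/-- **The block theorem.**  For a representation `ω` of `G` on `𝓢(ℝ^σ)` that is Heisenberg-covariant over a
multiplicative family of phase maps `γ` and has unitary lifts ((w2)+(w2′)), data (K), (A), (W) of the module
docstring make `((k₁, t, k₂), f) ↦ ω(κ k₁ · a t · κ k₂) f` jointly continuous into `𝓢`.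
[cite: Folland1989, §4.2, the Schur remark p. 156] -/
theorem continuous_uncurry_kakBlock (ω : Representation ℂ G (SR σ)) {γ : G → PhaseMap σ}
    (hγ : ∀ g g' pq, γ (g * g') pq = γ g (γ g' pq))
    (hcov : IsPhaseCovariantS γ (fun g => ω g)) (hlift : ∀ g, HasUnitaryLift[σ] (ω g))
    (κ : K →* G) (a : ℝ → G) (ha : ∀ s t, a (s + t) = a s * a t)
    {WK : K → ((SR σ) →L[ℂ] SR σ)}
    (hWK : IsPhaseCovariantS (fun k => γ (κ k)) (fun k => ((WK k : (SR σ) →L[ℂ] SR σ) : (SR σ) →ₗ[ℂ] SR σ)))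
    (hWKl : ∀ k, HasUnitaryLift[σ] ((WK k : (SR σ) →L[ℂ] SR σ) : (SR σ) →ₗ[ℂ] SR σ))
    (hWKc : Continuous fun x : K × SR σ => WK x.1 x.2)
    (hvac : Continuous fun k => ω (κ k) (hermitePi 0))
    {WA : ℝ → ((SR σ) →L[ℂ] SR σ)}
    (hWA : IsPhaseCovariantS (fun t => γ (a t)) (fun t => ((WA t : (SR σ) →L[ℂ] SR σ) : (SR σ) →ₗ[ℂ] SR σ)))
    (hWAl : ∀ t, HasUnitaryLift[σ] ((WA t : (SR σ) →L[ℂ] SR σ) : (SR σ) →ₗ[ℂ] SR σ))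
    (hWAc : Continuous fun x : ℝ × SR σ => WA x.1 x.2)
    (hWA_add : ∀ s t f, WA (s + t) f = WA s (WA t f))
    (w : K) (hw : ∀ t, κ w * a t * (κ w)⁻¹ = a (-t)) :
    Continuous fun x : (K × ℝ × K) × SR σ => ω (κ x.1.1 * a x.1.2.1 * κ x.1.2.2) x.2 := by
  -- (K)
  have hAcov : IsPhaseCovariantS (fun k => γ (κ k)) (fun k => ω (κ k)) := fun k p q f => hcov (κ k) p q f
  have hWKvac : Continuous fun k => WK k (hermitePi 0) := hWKc.comp (continuous_id.prodMk continuous_const)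
  obtain ⟨c, hc, hc1, hcW⟩ :=
    exists_continuous_smul_of_vacuum hAcov (fun k => hlift (κ k)) hvac hWK hWKl hWKvac
  have hc0 : ∀ k, c k ≠ 0 := fun k h0 => by simpa [h0] using hc1 k
  -- (A)+(W)
  have hBcov : IsPhaseCovariantS (fun t => γ (a t)) (fun t => ω (a t)) := fun t p q f => hcov (a t) p q f
  have hB2 : ∀ t f, ω (a t) f = ω (a (t / 2)) (ω (a (t / 2)) f) := fun t f => by
    conv_lhs => rw [← add_halves t, ha, map_mul]
    rfl
  have hWA0 : ∀ f, WA 0 f = f := fun f => by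
    obtain ⟨U, hU⟩ := hWAl 0
    have h1 : WA 0 (WA 0 f) = WA 0 f := by rw [← hWA_add, add_zero]
    have h2 : WA 0 (WA 0 f - f) = 0 := by rw [map_sub, h1, sub_self]
    by_contra hne
    have h3 : WA 0 f - f ≠ 0 := sub_ne_zero.2 hne
    have := ne_zero_of_liftsTo hU h3
    simp only [ContinuousLinearMap.coe_coe] at this
    exact this h2
  have hV2 : ∀ t f, WA t f = WA (t / 2) (WA (t / 2) f) := fun t f => by
    conv_lhs => rw [← add_halves t, hWA_add]
  have hBinv : ∀ t f, ω (a t) (ω (a (-t)) f) = f := fun t f => by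
    rw [← Module.End.mul_apply, ← map_mul, oneParam_mul_neg ha, map_one, Module.End.one_apply]
  have hVinv : ∀ t f, WA t (WA (-t) f) = f := fun t f => by
    rw [← hWA_add, add_neg_cancel, hWA0]
  have hY : ∀ (p q : σ → ℝ) (f : SR σ), WK w (rhoS p q f) = rhoS (γ (κ w) (p, q)).1 (γ (κ w) (p, q)).2 (WK w f) :=
    fun p q f => by
      have h1 := hWK w p q f
      simpa only [ContinuousLinearMap.coe_coe] using h1
  have hφ : ∀ t pq, γ (κ w) (γ (a t) pq) = γ (a (-t)) (γ (κ w) pq) := fun t pq => by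
    rw [← hγ, ← hγ, ← hw t, inv_mul_cancel_right]
  have hw' : ∀ t, κ w * a t = a (-t) * κ w := fun t => by rw [← hw t, inv_mul_cancel_right]
  have hYB : ∀ t f, WK w (ω (a t) f) = ω (a (-t)) (WK w f) := fun t f => by
    have h1 : WK w (ω (a t) f) = (c w)⁻¹ • ω (κ w) (ω (a t) f) := by
      rw [hcW, smul_smul, inv_mul_cancel₀ (hc0 w), one_smul]
    rw [h1, ← Module.End.mul_apply, ← map_mul, hw' t, map_mul, Module.End.mul_apply, hcW w f, map_smul,
      smul_smul, inv_mul_cancel₀ (hc0 w), one_smul]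
  obtain ⟨d, hd, -, hdV⟩ := exists_continuous_smul_of_weyl hBcov (fun t => hlift (a t)) hWA hWAl
    (fun f => hWAc.comp (continuous_id.prodMk continuous_const)) hB2 hV2 hBinv hVinv hY (hWKl w) hφ hYB
  -- assembly of the block
  have hformula : (fun x : (K × ℝ × K) × SR σ => ω (κ x.1.1 * a x.1.2.1 * κ x.1.2.2) x.2) =
      fun x => (c x.1.1 * (d x.1.2.1 * c x.1.2.2)) • WK x.1.1 (WA x.1.2.1 (WK x.1.2.2 x.2)) := by
    funext x
    simp only [map_mul, Module.End.mul_apply, hcW, hdV, map_smul, smul_smul]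
    congr 1
    ring
  rw [hformula]
  refine ((hc.comp (continuous_fst.comp continuous_fst)).mul
    ((hd.comp (continuous_fst.comp (continuous_snd.comp continuous_fst))).mul
      (hc.comp (continuous_snd.comp (continuous_snd.comp continuous_fst))))).smul ?_
  have h3 : Continuous fun x : (K × ℝ × K) × SR σ => WK x.1.2.2 x.2 :=
    hWKc.comp ((continuous_snd.comp (continuous_snd.comp continuous_fst)).prodMk continuous_snd)
  have h2 : Continuous fun x : (K × ℝ × K) × SR σ => WA x.1.2.1 (WK x.1.2.2 x.2) :=
    hWAc.comp ((continuous_fst.comp (continuous_snd.comp continuous_fst)).prodMk h3)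
  exact hWKc.comp ((continuous_fst.comp continuous_fst).prodMk h2)

end Block

/-! ## 5. Descent along the proper surjection `K × ℝ × K → G` -/

section Descent

variable {G : Type*} [Group G] [TopologicalSpace G]

omit [Group G] in
/-- **Descent of joint continuity along a proper surjection.**  If `m : P → G` is proper and surjective then
`m × id_X` is a quotient map, so `(g, x) ↦ F g x` is continuous iff `(p, x) ↦ F (m p) x` is. [folklore] -/
theorem continuous_uncurry_of_isProperMap {P X Y : Type*} [TopologicalSpace P] [TopologicalSpace X]
    [TopologicalSpace Y] {m : P → G} (hm : IsProperMap m) (hsurj : Function.Surjective m) {F : G → X → Y}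
    (hF : Continuous fun x : P × X => F (m x.1) x.2) : Continuous fun x : G × X => F x.1 x.2 := by
  have hq : Topology.IsQuotientMap (Prod.map m (id : X → X)) :=
    (hm.prodMap isProperMap_id).isClosedMap.isQuotientMap (hm.continuous.prodMap continuous_id)
      (hsurj.prodMap Function.surjective_id)
  exact hq.continuous_iff.2 hF

variable {K : Type*} [Group K] [TopologicalSpace K]

/-- **(w1) from (w2)+(w2′)+(K)+(A)+(W)+(M), joint form**: `(g, f) ↦ ω g f` is continuous `G × 𝓢 → 𝓢`.
[cite: Folland1989, §4.2, the Schur remark p. 156] -/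
theorem continuous_uncurry_of_kak (ω : Representation ℂ G (SR σ)) {γ : G → PhaseMap σ}
    (hγ : ∀ g g' pq, γ (g * g') pq = γ g (γ g' pq))
    (hcov : IsPhaseCovariantS γ (fun g => ω g)) (hlift : ∀ g, HasUnitaryLift[σ] (ω g))
    (κ : K →* G) (a : ℝ → G) (ha : ∀ s t, a (s + t) = a s * a t)
    {WK : K → ((SR σ) →L[ℂ] SR σ)}
    (hWK : IsPhaseCovariantS (fun k => γ (κ k)) (fun k => ((WK k : (SR σ) →L[ℂ] SR σ) : (SR σ) →ₗ[ℂ] SR σ)))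
    (hWKl : ∀ k, HasUnitaryLift[σ] ((WK k : (SR σ) →L[ℂ] SR σ) : (SR σ) →ₗ[ℂ] SR σ))
    (hWKc : Continuous fun x : K × SR σ => WK x.1 x.2)
    (hvac : Continuous fun k => ω (κ k) (hermitePi 0))
    {WA : ℝ → ((SR σ) →L[ℂ] SR σ)}
    (hWA : IsPhaseCovariantS (fun t => γ (a t)) (fun t => ((WA t : (SR σ) →L[ℂ] SR σ) : (SR σ) →ₗ[ℂ] SR σ)))
    (hWAl : ∀ t, HasUnitaryLift[σ] ((WA t : (SR σ) →L[ℂ] SR σ) : (SR σ) →ₗ[ℂ] SR σ))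
    (hWAc : Continuous fun x : ℝ × SR σ => WA x.1 x.2)
    (hWA_add : ∀ s t f, WA (s + t) f = WA s (WA t f))
    (w : K) (hw : ∀ t, κ w * a t * (κ w)⁻¹ = a (-t))
    (hm : IsProperMap fun p : K × ℝ × K => κ p.1 * a p.2.1 * κ p.2.2)
    (hsurj : Function.Surjective fun p : K × ℝ × K => κ p.1 * a p.2.1 * κ p.2.2) :
    Continuous fun x : G × SR σ => ω x.1 x.2 :=
  continuous_uncurry_of_isProperMap hm hsurj (F := fun g f => ω g f)
    (continuous_uncurry_kakBlock ω hγ hcov hlift κ a ha hWK hWKl hWKc hvac hWA hWAl hWAc hWA_add w hw)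

/-- **(w1) from (w2)+(w2′)+(K)+(A)+(W)+(M)**: every orbit map `g ↦ ω g f` is continuous into `𝓢(ℝ^σ)`.
[cite: Folland1989, §4.2, the Schur remark p. 156] -/
theorem continuous_apply_of_kak (ω : Representation ℂ G (SR σ)) {γ : G → PhaseMap σ}
    (hγ : ∀ g g' pq, γ (g * g') pq = γ g (γ g' pq))
    (hcov : IsPhaseCovariantS γ (fun g => ω g)) (hlift : ∀ g, HasUnitaryLift[σ] (ω g))
    (κ : K →* G) (a : ℝ → G) (ha : ∀ s t, a (s + t) = a s * a t)
    {WK : K → ((SR σ) →L[ℂ] SR σ)}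
    (hWK : IsPhaseCovariantS (fun k => γ (κ k)) (fun k => ((WK k : (SR σ) →L[ℂ] SR σ) : (SR σ) →ₗ[ℂ] SR σ)))
    (hWKl : ∀ k, HasUnitaryLift[σ] ((WK k : (SR σ) →L[ℂ] SR σ) : (SR σ) →ₗ[ℂ] SR σ))
    (hWKc : Continuous fun x : K × SR σ => WK x.1 x.2)
    (hvac : Continuous fun k => ω (κ k) (hermitePi 0))
    {WA : ℝ → ((SR σ) →L[ℂ] SR σ)}
    (hWA : IsPhaseCovariantS (fun t => γ (a t)) (fun t => ((WA t : (SR σ) →L[ℂ] SR σ) : (SR σ) →ₗ[ℂ] SR σ)))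
    (hWAl : ∀ t, HasUnitaryLift[σ] ((WA t : (SR σ) →L[ℂ] SR σ) : (SR σ) →ₗ[ℂ] SR σ))
    (hWAc : Continuous fun x : ℝ × SR σ => WA x.1 x.2)
    (hWA_add : ∀ s t f, WA (s + t) f = WA s (WA t f))
    (w : K) (hw : ∀ t, κ w * a t * (κ w)⁻¹ = a (-t))
    (hm : IsProperMap fun p : K × ℝ × K => κ p.1 * a p.2.1 * κ p.2.2)
    (hsurj : Function.Surjective fun p : K × ℝ × K => κ p.1 * a p.2.1 * κ p.2.2) (f : SR σ) :
    Continuous fun g => ω g f :=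
  (continuous_uncurry_of_kak ω hγ hcov hlift κ a ha hWK hWKl hWKc hvac hWA hWAl hWAc hWA_add w hw hm hsurj).comp
    (continuous_id.prodMk continuous_const)

omit [DecidableEq σ] [TopologicalSpace G] in
/-- The phase maps `g ↦ ⇑(ι𝕎 g)` of a homomorphism into the symplectic group are multiplicative. [folklore] -/
theorem symplecticPhaseMap_mul (ι𝕎 : G →* SpR σ) (g g' : G) (pq : PV σ) :
    ((ι𝕎 (g * g')).1 : (PV σ) ≃ₗ[ℝ] PV σ) pq = ((ι𝕎 g).1 : (PV σ) ≃ₗ[ℝ] PV σ) (((ι𝕎 g').1 : (PV σ) ≃ₗ[ℝ] PV σ) pq) := by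
  rw [map_mul]
  rfl

/-- **The archimedean Weil datum from its algebraic clauses.**  A representation `ω` of `G` on `𝓢(ℝ^σ)` that is
Heisenberg-covariant over `ι𝕎 : G →* Sp` with unitary lifts ((w2)+(w2′)) and admits data (K), (A), (W), (M)
IS an `IsArchWeilDatum ι𝕎 ω` — (w1) is derived, not assumed. [cite: Folland1989, §4.2, the Schur remark p. 156] -/
theorem isArchWeilDatum_of_kak {ι𝕎 : G →* SpR σ} {ω : Representation ℂ G (SR σ)}
    (hcov : IsPhaseCovariantS (fun g => ⇑((ι𝕎 g).1 : (PV σ) ≃ₗ[ℝ] PV σ)) (fun g => ω g))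
    (hlift : ∀ g, HasUnitaryLift[σ] (ω g))
    (κ : K →* G) (a : ℝ → G) (ha : ∀ s t, a (s + t) = a s * a t)
    {WK : K → ((SR σ) →L[ℂ] SR σ)}
    (hWK : IsPhaseCovariantS (fun k => ⇑((ι𝕎 (κ k)).1 : (PV σ) ≃ₗ[ℝ] PV σ))
      (fun k => ((WK k : (SR σ) →L[ℂ] SR σ) : (SR σ) →ₗ[ℂ] SR σ)))
    (hWKl : ∀ k, HasUnitaryLift[σ] ((WK k : (SR σ) →L[ℂ] SR σ) : (SR σ) →ₗ[ℂ] SR σ))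
    (hWKc : Continuous fun x : K × SR σ => WK x.1 x.2)
    (hvac : Continuous fun k => ω (κ k) (hermitePi 0))
    {WA : ℝ → ((SR σ) →L[ℂ] SR σ)}
    (hWA : IsPhaseCovariantS (fun t => ⇑((ι𝕎 (a t)).1 : (PV σ) ≃ₗ[ℝ] PV σ))
      (fun t => ((WA t : (SR σ) →L[ℂ] SR σ) : (SR σ) →ₗ[ℂ] SR σ)))
    (hWAl : ∀ t, HasUnitaryLift[σ] ((WA t : (SR σ) →L[ℂ] SR σ) : (SR σ) →ₗ[ℂ] SR σ))
    (hWAc : Continuous fun x : ℝ × SR σ => WA x.1 x.2)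
    (hWA_add : ∀ s t f, WA (s + t) f = WA s (WA t f))
    (w : K) (hw : ∀ t, κ w * a t * (κ w)⁻¹ = a (-t))
    (hm : IsProperMap fun p : K × ℝ × K => κ p.1 * a p.2.1 * κ p.2.2)
    (hsurj : Function.Surjective fun p : K × ℝ × K => κ p.1 * a p.2.1 * κ p.2.2) :
    IsArchWeilDatum ι𝕎 ω where
  continuous_apply := continuous_apply_of_kak ω (symplecticPhaseMap_mul ι𝕎) hcov hlift κ a ha hWK hWKl hWKc hvac
    hWA hWAl hWAc hWA_add w hw hm hsurj
  covariant := hcov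
  exists_lift := hlift

/-- **The purely compact case** (places where the group is compact): if an explicit covariant family `W` with
unitary lifts, jointly continuous on `G × 𝓢`, exists on ALL of `G` and the vacuum orbit of `ω` is continuous, then
`ω` is an `IsArchWeilDatum`. [cite: Folland1989, §4.2, the Schur remark p. 156] -/
theorem isArchWeilDatum_of_vacuum {ι𝕎 : G →* SpR σ} {ω : Representation ℂ G (SR σ)}
    (hcov : IsPhaseCovariantS (fun g => ⇑((ι𝕎 g).1 : (PV σ) ≃ₗ[ℝ] PV σ)) (fun g => ω g))
    (hlift : ∀ g, HasUnitaryLift[σ] (ω g)) (hvac : Continuous fun g => ω g (hermitePi 0))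
    {W : G → ((SR σ) →L[ℂ] SR σ)}
    (hW : IsPhaseCovariantS (fun g => ⇑((ι𝕎 g).1 : (PV σ) ≃ₗ[ℝ] PV σ))
      (fun g => ((W g : (SR σ) →L[ℂ] SR σ) : (SR σ) →ₗ[ℂ] SR σ)))
    (hWl : ∀ g, HasUnitaryLift[σ] ((W g : (SR σ) →L[ℂ] SR σ) : (SR σ) →ₗ[ℂ] SR σ))
    (hWc : Continuous fun x : G × SR σ => W x.1 x.2) :
    IsArchWeilDatum ι𝕎 ω where
  continuous_apply f := (continuous_uncurry_of_vacuum hcov hlift hvac hW hWl hWc).comp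
    (continuous_id.prodMk (continuous_const (y := f)))
  covariant := hcov
  exists_lift := hlift

end Descent

/-! ## 6. The compact part realised by `μ₀ = unitaryOpPi` (the form the junction files use) -/

section Unitary

variable {G : Type*} [Group G] [TopologicalSpace G] {K : Type*} [Group K] [TopologicalSpace K]

omit [Group K] [TopologicalSpace K] in
/-- `k ↦ μ₀(ιK k)|_𝓢` is Heisenberg-covariant over `realify ∘ ιK`. [cite: Folland1989, §4.2, (4.23)] -/
theorem isRhoCovariantS_unitaryOpPi (ιK : K → Matrix.unitaryGroup σ ℂ) :
    IsRhoCovariantS ιK (fun k => ((unitaryOpPi (ιK k) : (SR σ) →L[ℂ] SR σ) : (SR σ) →ₗ[ℂ] SR σ)) :=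
  isRhoCovariantS_of_toL2_eq_smul (fun _ => (1 : ℂ)) fun k f => by
    rw [one_smul]
    exact toL2_unitaryOpPi (ιK k) f

/-- **The datum, with (K) discharged by `μ₀`.**  If on `κ(K)` the symplectic action `ι𝕎` is through unitary
matrices `ιK k ∈ U(σ)` (as real phase-space maps), `ιK` is continuous, and the vacuum orbit `k ↦ ω(κ k) h₀` is
continuous (e.g. `ω(κ k) h₀ = χ(k) • h₀` with `χ` continuous), then (A)+(W)+(M) make `ω` an `IsArchWeilDatum`.
[cite: Folland1989, §4.2, the Schur remark p. 156; Prop. (4.39)] -/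
theorem isArchWeilDatum_of_kak_unitary {ι𝕎 : G →* SpR σ} {ω : Representation ℂ G (SR σ)}
    (hcov : IsPhaseCovariantS (fun g => ⇑((ι𝕎 g).1 : (PV σ) ≃ₗ[ℝ] PV σ)) (fun g => ω g))
    (hlift : ∀ g, HasUnitaryLift[σ] (ω g))
    (κ : K →* G) (ιK : K → Matrix.unitaryGroup σ ℂ) (hιK : Continuous ιK)
    (hreal : ∀ k pq, ((ι𝕎 (κ k)).1 : (PV σ) ≃ₗ[ℝ] PV σ) pq = realify (ιK k) pq)
    (hvac : Continuous fun k => ω (κ k) (hermitePi 0))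
    (a : ℝ → G) (ha : ∀ s t, a (s + t) = a s * a t)
    {WA : ℝ → ((SR σ) →L[ℂ] SR σ)}
    (hWA : IsPhaseCovariantS (fun t => ⇑((ι𝕎 (a t)).1 : (PV σ) ≃ₗ[ℝ] PV σ))
      (fun t => ((WA t : (SR σ) →L[ℂ] SR σ) : (SR σ) →ₗ[ℂ] SR σ)))
    (hWAl : ∀ t, HasUnitaryLift[σ] ((WA t : (SR σ) →L[ℂ] SR σ) : (SR σ) →ₗ[ℂ] SR σ))
    (hWAc : Continuous fun x : ℝ × SR σ => WA x.1 x.2)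
    (hWA_add : ∀ s t f, WA (s + t) f = WA s (WA t f))
    (w : K) (hw : ∀ t, κ w * a t * (κ w)⁻¹ = a (-t))
    (hm : IsProperMap fun p : K × ℝ × K => κ p.1 * a p.2.1 * κ p.2.2)
    (hsurj : Function.Surjective fun p : K × ℝ × K => κ p.1 * a p.2.1 * κ p.2.2) :
    IsArchWeilDatum ι𝕎 ω := by
  have hWKc : Continuous fun x : K × SR σ => unitaryOpPi (ιK x.1) x.2 :=
    continuous_unitaryOpPi_uncurry.comp (f := fun x : K × (SR σ) => (ιK x.1, x.2))
      ((hιK.comp continuous_fst).prodMk continuous_snd)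
  have hWKl : ∀ k, HasUnitaryLift[σ] ((unitaryOpPi (ιK k) : (SR σ) →L[ℂ] SR σ) : (SR σ) →ₗ[ℂ] SR σ) :=
    fun k => ⟨_, liftsTo_unitaryOpPi (ιK k)⟩
  refine isArchWeilDatum_of_kak hcov hlift κ a ha (WK := fun k => unitaryOpPi (ιK k)) ?_ hWKl hWKc
    hvac hWA hWAl hWAc hWA_add w hw hm hsurj
  intro k p q f
  have h1 := (isRhoCovariantS_unitaryOpPi ιK) k p q f
  beta_reduce at h1 ⊢
  rw [hreal k (p, q)]
  exact h1

omit [Group K] [TopologicalSpace K] in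
/-- **The purely compact case, with (K) discharged by `μ₀`** (compact members of the dual pair).
[cite: Folland1989, §4.2, the Schur remark p. 156; Prop. (4.39)] -/
theorem isArchWeilDatum_of_vacuum_unitary {ι𝕎 : G →* SpR σ} {ω : Representation ℂ G (SR σ)}
    (hcov : IsPhaseCovariantS (fun g => ⇑((ι𝕎 g).1 : (PV σ) ≃ₗ[ℝ] PV σ)) (fun g => ω g))
    (hlift : ∀ g, HasUnitaryLift[σ] (ω g))
    (ιG : G → Matrix.unitaryGroup σ ℂ) (hιG : Continuous ιG)
    (hreal : ∀ g pq, ((ι𝕎 g).1 : (PV σ) ≃ₗ[ℝ] PV σ) pq = realify (ιG g) pq)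
    (hvac : Continuous fun g => ω g (hermitePi 0)) :
    IsArchWeilDatum ι𝕎 ω := by
  have hWc : Continuous fun x : G × SR σ => unitaryOpPi (ιG x.1) x.2 :=
    continuous_unitaryOpPi_uncurry.comp (f := fun x : G × (SR σ) => (ιG x.1, x.2))
      ((hιG.comp continuous_fst).prodMk continuous_snd)
  have hWl : ∀ g, HasUnitaryLift[σ] ((unitaryOpPi (ιG g) : (SR σ) →L[ℂ] SR σ) : (SR σ) →ₗ[ℂ] SR σ) :=
    fun g => ⟨_, liftsTo_unitaryOpPi (ιG g)⟩
  refine isArchWeilDatum_of_vacuum hcov hlift hvac (W := fun g => unitaryOpPi (ιG g)) ?_ hWl hWc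
  intro g p q f
  have h1 := (isRhoCovariantS_unitaryOpPi ιG) g p q f
  beta_reduce at h1 ⊢
  rw [hreal g (p, q)]
  exact h1

end Unitary

end Literature.NumberTheory.Weil1964
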